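import Summits.AtomisticToContinuum.FouriersLaw.Theorems.PhononMeanFreePathCoherentDephasingStrictAbsorptionLandauerWitnessAux1
import Literature.MathematicalPhysics.KineticTheory.MomentumHermiteLadder
import Summits.AtomisticToContinuum.FouriersLaw.Theorems.PhononMeanFreePathCoherentDephasingResponseStatics
import Summits.AtomisticToContinuum.FouriersLaw.Theorems.BondHeatUncertaintyLightConeBondHeatGibbsByParts

/-!
# Strict absorption, sub-goal K3 (2/3): time integration and truncation of the witnessed coherent bound
# (crux `PhononMeanFreePath.CoherentDephasing`, stmt-AtomisticToContinuum-11810; line `Sketch`, lead c2)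

Continuation of `…LandauerWitnessAux1`: the witnessed pointwise bound is integrated in time with the Bakry–Émery
dissipation inequality (BOTH bath gradients kept) — `witness_integrated` — and transferred from compactly supported
truncations `χ_k p₀` to the kicked momentum `p₀` itself by dominated convergence and Fatou — `witness_lintegral_le` /
`sa_witnessLintegral` (registered sub-goal):

  `∫_{t>0} { (∫g²)[⟨p₀,K_tp₀⟩² + ⟨p_N,K_tp₀⟩²] + ⟨p₀g, K_tp₀⟩² } dt ≤ (∫g²)·T²/(2γ)`

for every centred `C¹` position observable `g = O(1+H)` of the `(N+1)`-site chain. No definition, no `sorry`.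
-/

noncomputable section

open MeasureTheory ProbabilityTheory Filter Topology Set
open scoped NNReal ENNReal ContDiff

namespace Summit.AtomisticToContinuum.FouriersLaw.Theorems.CoherentDephasing.StrictAbsorption

open Literature.MathematicalPhysics.KineticTheory.HeatConduction
open Literature.MathematicalPhysics.KineticTheory Literature.Probability.Process OscillatorChain
open Summit.AtomisticToContinuum.FouriersLaw.Theorems.IncoherentBounded
open Summit.AtomisticToContinuum.FouriersLaw.Theorems.SubdiffusiveBondHeat
open Summit.AtomisticToContinuum.FouriersLaw.Cruxes.SuperadditiveResistance.FloatingProbeBypassLaplacian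

section Chain

variable {ω₂ lam β γ : ℝ} (hω : 0 < ω₂) (hl : 0 ≤ lam) (hβ : 0 < β) (hγ : 0 < γ) {N : ℕ} (hN : 0 < N)
  {T : ℝ} (hT : 0 < T)
include hω hl hβ hγ hN hT

/-- **The witnessed coherent bound, integrated in time, for a compactly supported observable.** For `F ∈ C_c(Ω)`,
`N ≥ 2` sites (distinct bath sites `0`, `N-1`) and a centred `C¹` position observable `g` with `|g| ≤ C_g(1+H)`:
`∫_{s>0} { (∫g²)[(∫p_0 K_sF)² + (∫p_{N-1}K_sF)²] + (∫ p_0 g K_sF)² } ds ≤ (∫g²)·(T/(2γ))·∫F² dμ_T`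
(the witnessed pointwise bound + the dissipation inequality `dissipation_lintegral_le'`, in which BOTH bath gradients
are kept). [folklore] -/
theorem witness_integrated (hN2 : 1 < N) {g : (Fin N → ℝ) → ℝ} (hg : ContDiff ℝ 1 g) {Cg : ℝ}
    (hgb : ∀ z : PhaseSpace N, |g z.1| ≤ Cg * (1 + (pinnedChain ω₂ lam β γ).hamiltonian N z))
    (hg0 : ∫ z, g z.1 ∂((pinnedChain ω₂ lam β γ).gibbsMeasure N T) = 0)
    {F : PhaseSpace N → ℝ} (hFc : Continuous F) (hFs : HasCompactSupport F) :
    ∫⁻ s in Ioi (0 : ℝ), ENNReal.ofReal ((∫ z, g z.1 ^ 2 ∂((pinnedChain ω₂ lam β γ).gibbsMeasure N T)) *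
        ((∫ x, x.2 ⟨0, hN⟩ * (∫ y, F y ∂((pinnedChain ω₂ lam β γ).transitionKernel N T T s.toNNReal x))
            ∂((pinnedChain ω₂ lam β γ).gibbsMeasure N T)) ^ 2 +
          (∫ x, x.2 ⟨N - 1, Nat.sub_lt hN one_pos⟩ *
            (∫ y, F y ∂((pinnedChain ω₂ lam β γ).transitionKernel N T T s.toNNReal x))
            ∂((pinnedChain ω₂ lam β γ).gibbsMeasure N T)) ^ 2) +
        (∫ x, (x.2 ⟨0, hN⟩ * g x.1) * (∫ y, F y ∂((pinnedChain ω₂ lam β γ).transitionKernel N T T s.toNNReal x))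
            ∂((pinnedChain ω₂ lam β γ).gibbsMeasure N T)) ^ 2) ≤
      ENNReal.ofReal ((∫ z, g z.1 ^ 2 ∂((pinnedChain ω₂ lam β γ).gibbsMeasure N T)) * (T / (2 * γ)) *
        ∫ x, F x ^ 2 ∂((pinnedChain ω₂ lam β γ).gibbsMeasure N T)) := by
  set P := pinnedChain ω₂ lam β γ with hP
  set μ := P.gibbsMeasure N T with hμ
  set j₀ : Fin N := ⟨0, hN⟩ with hj₀
  set jN : Fin N := ⟨N - 1, Nat.sub_lt hN one_pos⟩ with hjN
  set V : ℝ := ∫ z, g z.1 ^ 2 ∂μ with hV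
  have hV0 : 0 ≤ V := integral_nonneg fun z => sq_nonneg _
  set U : ℝ → PhaseSpace N → ℝ := fun s z => ∫ y, F y ∂(P.transitionKernel N T T s.toNNReal z) with hU
  have hjj : j₀ ≠ jN := by
    intro h
    have := congrArg Fin.val h
    simp only [hj₀, hjN] at this
    omega
  -- the dissipation inequality, with both bath gradients kept
  have hD := dissipation_lintegral_le' hω hl hβ hγ hN hT hFc hFs
  set X : ℝ≥0∞ := ∫⁻ s in Ioi (0 : ℝ), ∫⁻ x, (ENNReal.ofReal (partialP j₀ (U s) x ^ 2) +
    ENNReal.ofReal (partialP jN (U s) x ^ 2)) ∂μ with hX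
  have hw0 : T ≤ (if j₀.val = 0 then T else 0) + (if j₀.val = N - 1 then T else 0) := by
    rw [if_pos (show j₀.val = 0 from rfl)]
    split_ifs <;> linarith [hT.le]
  have hwN : T ≤ (if jN.val = 0 then T else 0) + (if jN.val = N - 1 then T else 0) := by
    rw [if_pos (show jN.val = N - 1 from rfl)]
    split_ifs <;> linarith [hT.le]
  have hsum : ∀ s x, T * partialP j₀ (U s) x ^ 2 + T * partialP jN (U s) x ^ 2 ≤
      ∑ i : Fin N, ((if i.val = 0 then T else 0) + (if i.val = N - 1 then T else 0)) * partialP i (U s) x ^ 2 := by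
    intro s x
    set f : Fin N → ℝ := fun i => ((if i.val = 0 then T else 0) + (if i.val = N - 1 then T else 0)) *
      partialP i (U s) x ^ 2 with hf
    have hf0 : ∀ i, 0 ≤ f i := fun i =>
      mul_nonneg (add_nonneg (by split_ifs <;> linarith [hT.le]) (by split_ifs <;> linarith [hT.le])) (sq_nonneg _)
    have hpair : ∑ i ∈ ({j₀, jN} : Finset (Fin N)), f i ≤ ∑ i, f i :=
      Finset.sum_le_univ_sum_of_nonneg hf0
    rw [Finset.sum_pair hjj] at hpair
    have h1 : T * partialP j₀ (U s) x ^ 2 ≤ f j₀ := mul_le_mul_of_nonneg_right hw0 (sq_nonneg _)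
    have h2 : T * partialP jN (U s) x ^ 2 ≤ f jN := mul_le_mul_of_nonneg_right hwN (sq_nonneg _)
    linarith
  have hpt : ∀ s x, ENNReal.ofReal (2 * γ * T) * (ENNReal.ofReal (partialP j₀ (U s) x ^ 2) +
      ENNReal.ofReal (partialP jN (U s) x ^ 2)) ≤
      ENNReal.ofReal (2 * (γ * ∑ i : Fin N,
        ((if i.val = 0 then T else 0) + (if i.val = N - 1 then T else 0)) * partialP i (U s) x ^ 2)) := by
    intro s x
    rw [← ENNReal.ofReal_add (sq_nonneg _) (sq_nonneg _), ← ENNReal.ofReal_mul (by positivity)]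
    refine ENNReal.ofReal_le_ofReal ?_
    nlinarith [hsum s x, hγ.le]
  have hkey : ENNReal.ofReal (2 * γ * T) * X ≤ ENNReal.ofReal (∫ x, F x ^ 2 ∂μ) := by
    refine le_trans ?_ hD
    rw [hX, ← lintegral_const_mul' _ _ ENNReal.ofReal_ne_top]
    refine lintegral_mono fun s => ?_
    rw [← lintegral_const_mul' _ _ ENNReal.ofReal_ne_top]
    exact lintegral_mono fun x => hpt s x
  -- the witnessed pointwise bound, integrated
  have hpw : ∫⁻ s in Ioi (0 : ℝ), ENNReal.ofReal (V * ((∫ x, x.2 j₀ * U s x ∂μ) ^ 2 + (∫ x, x.2 jN * U s x ∂μ) ^ 2) +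
      (∫ x, (x.2 j₀ * g x.1) * U s x ∂μ) ^ 2) ≤ ENNReal.ofReal (T ^ 2 * V) * X := by
    rw [hX, ← lintegral_const_mul' _ _ ENNReal.ofReal_ne_top]
    refine setLIntegral_mono' measurableSet_Ioi fun s hs => ?_
    refine (witness_pointwise hω hl hβ hγ hN hT hg hgb hg0 hFc hFs hs).trans ?_
    exact mul_le_mul_right (le_lintegral_add _ _) _
  calc ∫⁻ s in Ioi (0 : ℝ), ENNReal.ofReal (V * ((∫ x, x.2 j₀ * U s x ∂μ) ^ 2 + (∫ x, x.2 jN * U s x ∂μ) ^ 2) +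
        (∫ x, (x.2 j₀ * g x.1) * U s x ∂μ) ^ 2)
      ≤ ENNReal.ofReal (T ^ 2 * V) * X := hpw
    _ = ENNReal.ofReal (V * (T / (2 * γ))) * (ENNReal.ofReal (2 * γ * T) * X) := by
        rw [← mul_assoc, ← ENNReal.ofReal_mul (by positivity)]
        congr 2
        field_simp
    _ ≤ ENNReal.ofReal (V * (T / (2 * γ))) * ENNReal.ofReal (∫ x, F x ^ 2 ∂μ) := by gcongr
    _ = ENNReal.ofReal (V * (T / (2 * γ)) * ∫ x, F x ^ 2 ∂μ) := by rw [← ENNReal.ofReal_mul (by positivity)]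

end Chain

/-! ## The (N+1)-site chain: truncation `χ_k p₀ → p₀` and the registered sub-goal -/

section Item

variable {ω₂ lam β γ : ℝ} (hω : 0 < ω₂) (hl : 0 ≤ lam) (hβ : 0 < β) (hγ : 0 < γ) {T : ℝ} (hT : 0 < T)
include hω hl hβ hγ hT

/-- **The witnessed Landauer bound for the kicked momentum itself.** For the `(N+1)`-site chain (`N ≥ 1`), a centred
`C¹` position observable `g` with `|g| ≤ C_g (1+H)`, `V = ∫ g² dμ_T` and `u_t = K_t p₀`:
`∫_{t>0} { V[(∫p₀u_t)² + (∫p_N u_t)²] + (∫ p₀ g u_t)² } dt ≤ V T²/(2γ)` (lower integral): truncate `p₀` to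
`χ_k p₀ ∈ C_c`, apply `witness_integrated` (`∫ (χ_k p₀)² ≤ ∫ p₀² = T`), pass to the limit in the three correlations by
dominated convergence and conclude by Fatou. [folklore] -/
theorem witness_lintegral_le {N : ℕ} (hN1 : 1 ≤ N) {g : (Fin (N + 1) → ℝ) → ℝ} (hg : ContDiff ℝ 1 g) {Cg : ℝ}
    (hgb : ∀ z : PhaseSpace (N + 1), |g z.1| ≤ Cg * (1 + (pinnedChain ω₂ lam β γ).hamiltonian (N + 1) z))
    (hg0 : ∫ z, g z.1 ∂((pinnedChain ω₂ lam β γ).gibbsMeasure (N + 1) T) = 0) :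
    ∫⁻ t in Ioi (0 : ℝ), ENNReal.ofReal ((∫ z, g z.1 ^ 2 ∂((pinnedChain ω₂ lam β γ).gibbsMeasure (N + 1) T)) *
        ((∫ z, z.2 0 * (∫ y, y.2 0 ∂((pinnedChain ω₂ lam β γ).transitionKernel (N + 1) T T t.toNNReal z))
            ∂((pinnedChain ω₂ lam β γ).gibbsMeasure (N + 1) T)) ^ 2 +
          (∫ z, z.2 (Fin.last N) * (∫ y, y.2 0 ∂((pinnedChain ω₂ lam β γ).transitionKernel (N + 1) T T t.toNNReal z))
            ∂((pinnedChain ω₂ lam β γ).gibbsMeasure (N + 1) T)) ^ 2) +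
        (∫ z, (z.2 0 * g z.1) * (∫ y, y.2 0 ∂((pinnedChain ω₂ lam β γ).transitionKernel (N + 1) T T t.toNNReal z))
            ∂((pinnedChain ω₂ lam β γ).gibbsMeasure (N + 1) T)) ^ 2) ≤
      ENNReal.ofReal ((∫ z, g z.1 ^ 2 ∂((pinnedChain ω₂ lam β γ).gibbsMeasure (N + 1) T)) * (T ^ 2 / (2 * γ))) := by
  set P := pinnedChain ω₂ lam β γ with hP
  set μ := P.gibbsMeasure (N + 1) T with hμ
  haveI : IsProbabilityMeasure μ := pinnedChain_isProbabilityMeasure_gibbsMeasure hω hl hβ.le γ (N + 1) hT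
  haveI hMK : ∀ t, IsMarkovKernel (P.transitionKernel (N + 1) T T t) := fun t =>
    pinnedChain_isMarkovKernel_transitionKernel hω hl hβ.le hγ.le (N + 1) T T t
  have hNp : 0 < N + 1 := Nat.succ_pos N
  have hN2 : 1 < N + 1 := by omega
  set V : ℝ := ∫ z, g z.1 ^ 2 ∂μ with hV
  have hV0 : 0 ≤ V := integral_nonneg fun z => sq_nonneg _
  -- the truncations `F_k = χ_k · p₀`
  set pL : PhaseSpace (N + 1) → ℝ := fun y => y.2 0 with hpL
  have hpLc : Continuous pL := by fun_prop
  set χ : ℕ → ContDiffBump (0 : PhaseSpace (N + 1)) := fun k =>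
    ⟨(k : ℝ) + 1, (k : ℝ) + 2, by positivity, by linarith⟩ with hχ
  set Fk : ℕ → PhaseSpace (N + 1) → ℝ := fun k y => (χ k) y * pL y with hFk
  have hFkc : ∀ k, Continuous (Fk k) := fun k => (χ k).continuous.mul hpLc
  have hFks : ∀ k, HasCompactSupport (Fk k) := fun k => (χ k).hasCompactSupport.mul_right
  have hFk_le : ∀ k y, |Fk k y| ≤ |pL y| := fun k y => by
    rw [hFk]; dsimp only; rw [abs_mul, abs_of_nonneg (χ k).nonneg]
    exact mul_le_of_le_one_left (abs_nonneg _) (χ k).le_one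
  have hFk_lim : ∀ y, Tendsto (fun k => Fk k y) atTop (𝓝 (pL y)) := by
    intro y
    refine tendsto_const_nhds.congr' ?_
    obtain ⟨k₀, hk₀⟩ := exists_nat_ge ‖y‖
    filter_upwards [eventually_ge_atTop k₀] with k hk
    rw [hFk]; dsimp only
    rw [(χ k).one_of_mem_closedBall, one_mul]
    rw [Metric.mem_closedBall, dist_zero_right]
    calc ‖y‖ ≤ k₀ := hk₀
      _ ≤ k := by exact_mod_cast hk
      _ ≤ (k : ℝ) + 1 := by linarith
  -- `∫ F_k² dμ ≤ ∫ p₀² dμ = T`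
  have hϑ0 : (0 : ℝ) < 1 / (4 * T) := by positivity
  have hϑ1 : 1 / (4 * T) < 1 / T := by
    rw [div_lt_div_iff₀ (by positivity) hT]; nlinarith
  have hexpμ := pinnedChain_integrable_exp_mul_hamiltonian_gibbsMeasure hω hl hβ.le γ (N + 1) hT hϑ1
  have hpL2 : Integrable (fun y => pL y ^ 2) μ :=
    integrable_of_abs_le_exp hexpμ (by fun_prop) (fun y => by
      rw [abs_of_nonneg (sq_nonneg _)]
      exact sq_momentum_le_exp (γ := γ) hω hl hβ.le hϑ0 y 0)
  have hFk2 : ∀ k, ∫ y, Fk k y ^ 2 ∂μ ≤ T := by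
    intro k
    rw [← integral_momentum_sq_gibbsMeasure (γ := γ) hω hl hβ hT (N + 1) 0]
    refine integral_mono_of_nonneg (ae_of_all _ fun y => sq_nonneg _) hpL2 (ae_of_all _ fun y => ?_)
    show Fk k y ^ 2 ≤ y.2 0 ^ 2
    exact (sq_le_sq' (abs_le.1 (hFk_le k y)).1 (abs_le.1 (hFk_le k y)).2).trans (le_of_eq (sq_abs _))
  -- the three weights
  set w₁ : PhaseSpace (N + 1) → ℝ := fun z => z.2 0 with hw₁
  set w₂ : PhaseSpace (N + 1) → ℝ := fun z => z.2 (Fin.last N) with hw₂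
  set w₃ : PhaseSpace (N + 1) → ℝ := fun z => z.2 0 * g z.1 with hw₃
  have hgc : Continuous fun z : PhaseSpace (N + 1) => g z.1 := hg.continuous.comp continuous_fst
  have hw₁c : Continuous w₁ := by fun_prop
  have hw₂c : Continuous w₂ := by fun_prop
  have hw₃c : Continuous w₃ := hw₁c.mul hgc
  have hH0 : ∀ y, 0 ≤ P.hamiltonian (N + 1) y := fun y => pinnedChain_hamiltonian_nonneg hω.le hl hβ.le γ (N + 1) y
  have hCg0 : 0 ≤ Cg := by
    have h := (abs_nonneg _).trans (hgb 0)
    have h1 : 0 < 1 + P.hamiltonian (N + 1) 0 := by linarith [hH0 0]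
    nlinarith
  set C₁ : ℝ := 2 * Real.exp (1 / (4 * T)) / (1 / (4 * T)) ^ 2 with hC₁
  have hw₁b : ∀ y, |w₁ y| ≤ (1 / 2 + 1 / (1 / (4 * T))) * Real.exp (1 / (4 * T) * P.hamiltonian (N + 1) y) :=
    fun y => abs_momentum_le_exp hω.le hl hβ.le hϑ0 y 0
  have hw₂b : ∀ y, |w₂ y| ≤ (1 / 2 + 1 / (1 / (4 * T))) * Real.exp (1 / (4 * T) * P.hamiltonian (N + 1) y) :=
    fun y => abs_momentum_le_exp hω.le hl hβ.le hϑ0 y (Fin.last N)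
  have hw₃b : ∀ y, |w₃ y| ≤ (Cg * C₁) * Real.exp (1 / (4 * T) * P.hamiltonian (N + 1) y) := by
    intro y
    rw [hw₃]; dsimp only; rw [abs_mul]
    have hp : |y.2 0| ≤ 1 + P.hamiltonian (N + 1) y := MeanFieldDuhamel.abs_snd_le hl hβ.le γ hω.le y 0
    calc |y.2 0| * |g y.1| ≤ (1 + P.hamiltonian (N + 1) y) * (Cg * (1 + P.hamiltonian (N + 1) y)) :=
          mul_le_mul hp (hgb y) (abs_nonneg _) (by linarith [hH0 y])
      _ = Cg * (1 + P.hamiltonian (N + 1) y) ^ 2 := by ring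
      _ ≤ Cg * (C₁ * Real.exp (1 / (4 * T) * P.hamiltonian (N + 1) y)) :=
          mul_le_mul_of_nonneg_left (one_add_sq_le_exp (pinnedChain_hamiltonian_nonneg hω.le hl hβ.le γ _ y) hϑ0) hCg0
      _ = (Cg * C₁) * Real.exp (1 / (4 * T) * P.hamiltonian (N + 1) y) := by ring
  -- approximating correlations and their limits, for a general continuous weight of exponential size
  have hconv : ∀ {w : PhaseSpace (N + 1) → ℝ} (_ : Continuous w) {A : ℝ}
      (_ : ∀ y, |w y| ≤ A * Real.exp (1 / (4 * T) * P.hamiltonian (N + 1) y)) (t : ℝ),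
      Tendsto (fun k => ∫ z, w z * (∫ y, Fk k y ∂(P.transitionKernel (N + 1) T T t.toNNReal z)) ∂μ) atTop
        (𝓝 (∫ z, w z * (∫ y, pL y ∂(P.transitionKernel (N + 1) T T t.toNNReal z)) ∂μ)) := by
    intro w hwc A hwb t
    -- dominated convergence inside the kernels
    have hin : ∀ z : PhaseSpace (N + 1),
        Tendsto (fun k => ∫ y, Fk k y ∂(P.transitionKernel (N + 1) T T t.toNNReal z)) atTop
          (𝓝 (∫ y, pL y ∂(P.transitionKernel (N + 1) T T t.toNNReal z))) := by
      intro z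
      have hexpK := pinnedChain_integrable_exp_mul_hamiltonian_transitionKernel hω hl hT hβ.le hγ.le hNp hϑ0 hϑ1
        t.toNNReal z
      have hbd : Integrable (fun y => |pL y|) (P.transitionKernel (N + 1) T T t.toNNReal z) :=
        integrable_of_abs_le_exp hexpK (by fun_prop) (fun y => by
          rw [abs_abs]; exact abs_momentum_le_exp hω.le hl hβ.le hϑ0 y 0)
      refine tendsto_integral_of_dominated_convergence (fun y => |pL y|)
        (fun k => (hFkc k).aestronglyMeasurable) hbd (fun k => ae_of_all _ fun y => ?_)
        (ae_of_all _ fun y => hFk_lim y)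
      rw [Real.norm_eq_abs]; exact hFk_le k y
    -- dominated convergence under `μ`
    have hdom : Integrable (fun z : PhaseSpace (N + 1) => |w z| *
        ∫ y, |pL y| ∂(P.transitionKernel (N + 1) T T t.toNNReal z)) μ :=
      integrable_mul_act hω hl hβ hγ hT (f := fun z : PhaseSpace (N + 1) => |w z|) (g := fun y => |pL y|)
        (continuous_abs.comp hwc) (by fun_prop)
        (fun y => by rw [abs_abs]; exact hwb y)
        (fun y => by rw [abs_abs]; exact abs_momentum_le_exp hω.le hl hβ.le hϑ0 y 0) t.toNNReal
    refine tendsto_integral_of_dominated_convergence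
      (fun z : PhaseSpace (N + 1) => |w z| * ∫ y, |pL y| ∂(P.transitionKernel (N + 1) T T t.toNNReal z))
      (fun k => ?_) hdom (fun k => ae_of_all _ fun z => ?_) (ae_of_all _ fun z => (hin z).const_mul (w z))
    · exact hwc.aestronglyMeasurable.mul
        ((hFkc k).stronglyMeasurable.integral_kernel
          (κ := P.transitionKernel (N + 1) T T t.toNNReal)).aestronglyMeasurable
    · rw [Real.norm_eq_abs, abs_mul]
      refine mul_le_mul_of_nonneg_left ?_ (abs_nonneg _)
      have hexpK := pinnedChain_integrable_exp_mul_hamiltonian_transitionKernel hω hl hT hβ.le hγ.le hNp hϑ0 hϑ1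
        t.toNNReal z
      have hbd : Integrable (fun y => |pL y|) (P.transitionKernel (N + 1) T T t.toNNReal z) :=
        integrable_of_abs_le_exp hexpK (by fun_prop) (fun y => by
          rw [abs_abs]; exact abs_momentum_le_exp hω.le hl hβ.le hϑ0 y 0)
      calc |∫ y, Fk k y ∂(P.transitionKernel (N + 1) T T t.toNNReal z)|
          ≤ ∫ y, |Fk k y| ∂(P.transitionKernel (N + 1) T T t.toNNReal z) := abs_integral_le_integral_abs
        _ ≤ ∫ y, |pL y| ∂(P.transitionKernel (N + 1) T T t.toNNReal z) :=
          integral_mono_of_nonneg (ae_of_all _ fun y => abs_nonneg _) hbd (ae_of_all _ fun y => hFk_le k y)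
  -- the combined sequences
  set ck : ℕ → ℝ → ℝ := fun k t =>
    V * ((∫ z, w₁ z * (∫ y, Fk k y ∂(P.transitionKernel (N + 1) T T t.toNNReal z)) ∂μ) ^ 2 +
      (∫ z, w₂ z * (∫ y, Fk k y ∂(P.transitionKernel (N + 1) T T t.toNNReal z)) ∂μ) ^ 2) +
    (∫ z, w₃ z * (∫ y, Fk k y ∂(P.transitionKernel (N + 1) T T t.toNNReal z)) ∂μ) ^ 2 with hck
  set c : ℝ → ℝ := fun t =>
    V * ((∫ z, w₁ z * (∫ y, pL y ∂(P.transitionKernel (N + 1) T T t.toNNReal z)) ∂μ) ^ 2 +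
      (∫ z, w₂ z * (∫ y, pL y ∂(P.transitionKernel (N + 1) T T t.toNNReal z)) ∂μ) ^ 2) +
    (∫ z, w₃ z * (∫ y, pL y ∂(P.transitionKernel (N + 1) T T t.toNNReal z)) ∂μ) ^ 2 with hc
  -- index bookkeeping `⟨0,_⟩ = 0`, `⟨N+1-1,_⟩ = Fin.last N`
  have e0 : (⟨0, hNp⟩ : Fin (N + 1)) = 0 := rfl
  have eN : (⟨N + 1 - 1, Nat.sub_lt hNp one_pos⟩ : Fin (N + 1)) = Fin.last N := Fin.ext (by simp)
  have hck_bound : ∀ k, ∫⁻ t in Ioi (0 : ℝ), ENNReal.ofReal (ck k t) ≤ ENNReal.ofReal (V * (T ^ 2 / (2 * γ))) := by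
    intro k
    have h := witness_integrated hω hl hβ hγ hNp hT hN2 hg hgb hg0 (hFkc k) (hFks k)
    simp only [e0, eN] at h
    refine h.trans (ENNReal.ofReal_le_ofReal ?_)
    calc V * (T / (2 * γ)) * ∫ x, Fk k x ^ 2 ∂μ ≤ V * (T / (2 * γ)) * T :=
          mul_le_mul_of_nonneg_left (hFk2 k) (by positivity)
      _ = V * (T ^ 2 / (2 * γ)) := by ring
  have hck_meas : ∀ k, Measurable (ck k) := by
    intro k
    have h1 := measurable_corr hω hl hβ hγ hT (f := w₁) hw₁c (hFkc k)
    have h2 := measurable_corr hω hl hβ hγ hT (f := w₂) hw₂c (hFkc k)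
    have h3 := measurable_corr hω hl hβ hγ hT (f := w₃) hw₃c (hFkc k)
    exact ((((h1.pow_const 2).add (h2.pow_const 2)).const_mul V).add (h3.pow_const 2))
  have hout : ∀ t, Tendsto (fun k => ck k t) atTop (𝓝 (c t)) := by
    intro t
    have h1 := hconv hw₁c hw₁b t
    have h2 := hconv hw₂c hw₂b t
    have h3 := hconv hw₃c hw₃b t
    exact (((h1.pow 2).add (h2.pow 2)).const_mul V).add (h3.pow 2)
  -- Fatou in `t`
  have hlim : ∀ t, liminf (fun k => ENNReal.ofReal (ck k t)) atTop = ENNReal.ofReal (c t) := fun t =>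
    (ENNReal.tendsto_ofReal (hout t)).liminf_eq
  calc ∫⁻ t in Ioi (0 : ℝ), ENNReal.ofReal (c t)
      = ∫⁻ t in Ioi (0 : ℝ), liminf (fun k => ENNReal.ofReal (ck k t)) atTop :=
        lintegral_congr fun t => (hlim t).symm
    _ ≤ liminf (fun k => ∫⁻ t in Ioi (0 : ℝ), ENNReal.ofReal (ck k t)) atTop :=
        lintegral_liminf_le fun k => (hck_meas k).ennreal_ofReal
    _ ≤ ENNReal.ofReal (V * (T ^ 2 / (2 * γ))) :=
        liminf_le_of_frequently_le' (Frequently.of_forall fun k => hck_bound k)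

end Item

/-- **Registered form of the witnessed Landauer bound for the kicked momentum** (stub `sa_witnessLintegral`; closed
statement of `witness_lintegral_le`). [folklore] -/
theorem sa_witnessLintegral :
    ∀ ω₂ lam β γ : ℝ, 0 < ω₂ → 0 ≤ lam → 0 < β → 0 < γ → ∀ T : ℝ, 0 < T → ∀ (N : ℕ) (hN : 1 ≤ N) (g : (Fin (N + 1) → ℝ) → ℝ) (Cg : ℝ), ContDiff ℝ 1 g → (∀ z : PhaseSpace (N + 1), |g z.1| ≤ Cg * (1 + (pinnedChain ω₂ lam β γ).hamiltonian (N + 1) z)) → ∫ z, g z.1 ∂((pinnedChain ω₂ lam β γ).gibbsMeasure (N + 1) T) = 0 → ∫⁻ t in Set.Ioi (0 : ℝ), ENNReal.ofReal ((∫ z, g z.1 ^ 2 ∂((pinnedChain ω₂ lam β γ).gibbsMeasure (N + 1) T)) * ((∫ z, z.2 0 * (∫ y, y.2 0 ∂((pinnedChain ω₂ lam β γ).transitionKernel (N + 1) T T t.toNNReal z)) ∂((pinnedChain ω₂ lam β γ).gibbsMeasure (N + 1) T)) ^ 2 + (∫ z, z.2 (Fin.last N) * (∫ y, y.2 0 ∂((pinnedChain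 ω₂ lam β γ).transitionKernel (N + 1) T T t.toNNReal z)) ∂((pinnedChain ω₂ lam β γ).gibbsMeasure (N + 1) T)) ^ 2) + (∫ z, (z.2 0 * g z.1) * (∫ y, y.2 0 ∂((pinnedChain ω₂ lam β γ).transitionKernel (N + 1) T T t.toNNReal z)) ∂((pinnedChain ω₂ lam β γ).gibbsMeasure (N + 1) T)) ^ 2) ≤ ENNReal.ofReal ((∫ z, g z.1 ^ 2 ∂((pinnedChain ω₂ lam β γ).gibbsMeasure (N + 1) T)) * (T ^ 2 / (2 * γ))) :=
  fun _ _ _ _ hω hl hβ hγ _ hT _ hN _ _ hg hgb hg0 => witness_lintegral_le hω hl hβ hγ hT hN hg hgb hg0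

end Summit.AtomisticToContinuum.FouriersLaw.Theorems.CoherentDephasing.StrictAbsorption

end
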